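import Mathlib
import Summits.NavierStokesRegularity.NavierStokesRegularity.Theorems.TaoLadderRungTwoBreakBlowupRigidityOnePeriodicCompanion
import HarnessLib

/-!
# DSS waves = shift-periodic BOUNDED admissible eternal solutions (existence level), and the classification
  stub `stub_eternalIsDSS` of K2(1) `TaoLadderRungTwoBreak.BlowupRigidityOne` (stmt-NavierStokesRegularity-20206)
  as an EQUIVALENCE with the bounded periodic-companion property

Sequel to `…PeriodicCompanion` (p819377). MODEL lattice ODEs only (Tao 2016 §4 (4.8) in the self-similar
log-time variables of §6.4; cell vocabulary `IsEternal` / `IsDSSWave` / `UniformBound` / `EternalSurvivingFwd`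
/ `Surviving` / `dssMu`); nothing in this file is a statement about the Navier–Stokes equations, and NO item
is closed by it (`--supports stmt-NavierStokesRegularity-20206`). DEF-FREE; general `m` except in the
stub-shaped corollary (`m = 4`).

* `inv_le_dssMu_of_shiftPeriodic` — for a shift-periodic UNIFORMLY BOUNDED admissible eternal solution
  surviving forward at `a = 1`, the lower half `(1+ε₀)⁻¹ ≤ μ` of (S₁)-survival of the delay is AUTOMATIC
  (the `a = 1`-weighted energy is multiplied by `((1+ε₀)μ)^q` per period while the base shells have bounded
  renormalised energy);
* `exists_survivingDSSWave_iff_shiftPeriodic` — **a table carries a non-trivial (S₁)-surviving admissible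
  DSS wave iff it carries a uniformly bounded shift-periodic admissible eternal solution with `T > 0`,
  `μ < 1`, surviving forward** (⇒ the tree's `dssEmbed` lemmas with period `|π|`; ⇐ part 1 + the above);
* `stub_eternalIsDSS_iff_boundedPeriodicCompanions` — the REGISTERED STUB SIGNATURE of `stub_eternalIsDSS`
  (skeleton `9d85f4d387c689cd`, verbatim) is EQUIVALENT to the bounded periodic-companion property.

HONEST LABEL: dictionary; the periodic-companion property (asymptotic shift-periodicity = rigidity of
surviving eternal solutions) is the OPEN content of the classification stub; nothing is proved about it;
`stub_eternalFromBlowup` untouched; no stub, crux or summit is proved; rung 0.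
-/

noncomputable section

-- the summit and its single sub-problem share the name (CONVENTIONS §1)
set_option linter.dupNamespace false

open Set Filter Topology MeasureTheory

namespace Summit.NavierStokesRegularity.NavierStokesRegularity.Theorems

namespace BlowupRigidityOne

open Literature.Analysis.FluidPDE Literature.Analysis.FluidPDE.TaoCascade

variable {m : ℕ}

/-- **Under a uniform bound the lower half of (S₁)-survival of the delay is automatic.** For a
shift-periodic (`W_{n+q}(σ) = W_n(σ - qT)`, `q ≥ 1`) uniformly bounded admissible eternal solution that
survives forward at exponent `a = 1`, the per-shell energy ratio of the delay satisfies
`(1+ε₀)⁻¹ ≤ μ = e^{2T}/(1+ε₀)^5`: along the period the `a = 1`-weighted energy is multiplied by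
`((1+ε₀) μ)^q` per `q` shells while the base shells have bounded renormalised energy `e^{2x}‖W_r(x)‖²`
(uniform bound backward, `bdd` clause forward), so survival forces `(1+ε₀) μ ≥ 1`.
[cite: Tao2016AveragedNS, §4 Lemma 4.1 (4.8)–(4.10) in self-similar variables, §6.4; cell vocabulary (`UniformBound`, `EternalSurvivingFwd`, `dssMu`)] -/
theorem inv_le_dssMu_of_shiftPeriodic {ε₀ T : ℝ} (hε : 0 < ε₀)
    {α : Fin m → Fin m → Fin m → ℤ × ℤ × ℤ → ℝ} {W : ℤ → ℝ → Em m}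
    (hW : IsEternal ε₀ α W) (hU : UniformBound W) {q : ℕ} (hq : 0 < q)
    (hper : ∀ (n : ℤ) (σ : ℝ), W (n + q) σ = W n (σ - q * T))
    (hS : EternalSurvivingFwd 1 ε₀ W) :
    (1 + ε₀) ^ (-(1 : ℝ)) ≤ dssMu ε₀ T := by
  have hb : 0 < 1 + ε₀ := by linarith
  -- a bound on the renormalised energy of every base shell, all log-times
  obtain ⟨C, hC⟩ := hU
  have hC0 : 0 ≤ C := (norm_nonneg _).trans (hC 0 0)
  choose σ₀ P hP using hW.bdd
  set Btot : ℝ := ∑ r : Fin q, (Real.exp (2 * σ₀ (r.val : ℤ)) * C ^ 2 + |P (r.val : ℤ)|) with hBtot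
  have hBr : ∀ (r : Fin q) (y : ℝ),
      Real.exp (2 * y) * ‖W (r.val : ℤ) y‖ ^ 2 ≤ Real.exp (2 * σ₀ (r.val : ℤ)) * C ^ 2 + |P (r.val : ℤ)| := by
    intro r y
    rcases le_total y (σ₀ (r.val : ℤ)) with h | h
    · have h1 : Real.exp (2 * y) ≤ Real.exp (2 * σ₀ (r.val : ℤ)) := Real.exp_le_exp.2 (by linarith)
      have h2 : ‖W (r.val : ℤ) y‖ ^ 2 ≤ C ^ 2 := pow_le_pow_left₀ (norm_nonneg _) (hC _ _) 2
      have h3 : Real.exp (2 * y) * ‖W (r.val : ℤ) y‖ ^ 2 ≤ Real.exp (2 * σ₀ (r.val : ℤ)) * C ^ 2 :=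
        mul_le_mul h1 h2 (by positivity) (Real.exp_pos _).le
      linarith [abs_nonneg (P (r.val : ℤ))]
    · have h3 := (hP (r.val : ℤ) y h).trans (le_abs_self _)
      have : 0 ≤ Real.exp (2 * σ₀ (r.val : ℤ)) * C ^ 2 := by positivity
      linarith
  have hBtot_ge : ∀ (r : Fin q) (y : ℝ), Real.exp (2 * y) * ‖W (r.val : ℤ) y‖ ^ 2 ≤ Btot := by
    intro r y
    refine (hBr r y).trans ?_
    rw [hBtot]
    exact Finset.single_le_sum
      (f := fun r' : Fin q => Real.exp (2 * σ₀ (r'.val : ℤ)) * C ^ 2 + |P (r'.val : ℤ)|)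
      (fun _ _ => by positivity) (Finset.mem_univ r)
  have hBtot0 : 0 ≤ Btot := by rw [hBtot]; exact Finset.sum_nonneg fun _ _ => by positivity
  -- the survival factor per shell
  set θ : ℝ := physWeight 1 ε₀ * Real.exp (2 * T) with hθ
  have hpw : physWeight 1 ε₀ = (1 + ε₀) / (1 + ε₀) ^ 5 := by unfold physWeight; rw [Real.rpow_one]
  have hpw0 : 0 ≤ physWeight 1 ε₀ := by rw [hpw]; positivity
  have hpw1 : physWeight 1 ε₀ ≤ 1 := by
    rw [hpw, div_le_one (pow_pos hb 5)]
    exact le_self_pow₀ (by linarith) (by norm_num)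
  have hθ0 : 0 ≤ θ := by rw [hθ]; positivity
  by_contra hlt
  push Not at hlt
  -- `μ < (1+ε₀)⁻¹` means `θ = (1+ε₀) μ < 1`
  have hθ1 : θ < 1 := by
    rw [Real.rpow_neg hb.le, Real.rpow_one] at hlt
    have e : θ = (1 + ε₀) * dssMu ε₀ T := by rw [hθ, hpw]; unfold dssMu; ring
    rw [e]
    calc (1 + ε₀) * dssMu ε₀ T < (1 + ε₀) * (1 + ε₀)⁻¹ := mul_lt_mul_of_pos_left hlt hb
      _ = 1 := mul_inv_cancel₀ hb.ne'
  obtain ⟨c, hc, H⟩ := hS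
  obtain ⟨K, hK⟩ := exists_pow_lt_of_lt_one (div_pos hc (by linarith : (0 : ℝ) < Btot + 1)) hθ1
  obtain ⟨n, hn, σ, -, hle⟩ := H (q * K)
  -- reduce shell `n = r + q k` to its base shell `r`
  set r : ℕ := n % q with hr
  set k : ℕ := n / q with hk
  have hnrk : n = r + q * k := by rw [hr, hk]; exact (Nat.mod_add_div n q).symm
  have hkK : K ≤ q * k := by
    have h1 : K ≤ k := by
      have := Nat.div_le_div_right (c := q) hn
      rwa [Nat.mul_div_cancel_left K hq] at this
    calc K = 1 * K := (one_mul K).symm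
      _ ≤ q * k := Nat.mul_le_mul hq h1
  have hred : W (n : ℤ) σ = W (r : ℤ) (σ - (k : ℝ) * (q : ℝ) * T) := shiftPeriodic_reduce hper n σ
  set y : ℝ := σ - (k : ℝ) * (q : ℝ) * T with hy
  have hexp : Real.exp (2 * σ) = Real.exp (2 * T) ^ (q * k) * Real.exp (2 * y) := by
    rw [← Real.exp_nat_mul, ← Real.exp_add, hy]; push_cast; ring_nf
  have hmain : physWeight 1 ε₀ ^ n * (Real.exp (2 * σ) * ‖W (n : ℤ) σ‖ ^ 2)
      = physWeight 1 ε₀ ^ r * θ ^ (q * k) * (Real.exp (2 * y) * ‖W (r : ℤ) y‖ ^ 2) := by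
    rw [hred, hexp, hnrk, pow_add, hθ, mul_pow]; ring
  have hrlt : r < q := by rw [hr]; exact Nat.mod_lt n hq
  have h1 : physWeight 1 ε₀ ^ r ≤ 1 := pow_le_one₀ hpw0 hpw1
  have h2 : θ ^ (q * k) ≤ θ ^ K := pow_le_pow_of_le_one hθ0 hθ1.le hkK
  have h3 : Real.exp (2 * y) * ‖W (r : ℤ) y‖ ^ 2 ≤ Btot := hBtot_ge ⟨r, hrlt⟩ y
  have h4 : c ≤ 1 * θ ^ K * Btot := by
    calc c ≤ physWeight 1 ε₀ ^ n * (Real.exp (2 * σ) * ‖W (n : ℤ) σ‖ ^ 2) := hle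
      _ = physWeight 1 ε₀ ^ r * θ ^ (q * k) * (Real.exp (2 * y) * ‖W (r : ℤ) y‖ ^ 2) := hmain
      _ ≤ 1 * θ ^ K * Btot := by
          apply mul_le_mul (mul_le_mul h1 h2 (by positivity) zero_le_one) h3 (by positivity)
            (by positivity)
  have h5 : θ ^ K * Btot < c := by
    have h6 : θ ^ K * Btot ≤ c / (Btot + 1) * Btot := mul_le_mul_of_nonneg_right hK.le hBtot0
    have h7 : c / (Btot + 1) * Btot < c := by
      rw [div_mul_eq_mul_div, div_lt_iff₀ (by linarith : (0 : ℝ) < Btot + 1)]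
      nlinarith
    linarith
  linarith

/-- **DSS WAVES = SHIFT-PERIODIC BOUNDED ETERNAL SOLUTIONS (existence level).** A table `α` (any `m`)
carries a non-trivial (S₁)-surviving admissible DSS wave iff it carries a uniformly bounded, shift-periodic
(`W_{n+q}(σ) = W_n(σ - qT)`, `q ≥ 1`, `T > 0`, sub-unitary ratio `e^{2T}/(1+ε₀)^5 < 1`) admissible
eternal solution surviving forward at exponent `1`. (⇒: the tree's `dssEmbed` with period `|π|`,
`IsDSSWave.isEternal_dssEmbed`, `uniformBound_dssEmbed`, `eternalSurvivingFwd_dssEmbed`; ⇐: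
`isDSSWave_of_shiftPeriodic` + `inv_le_dssMu_of_shiftPeriodic`.)
[cite: Tao2016AveragedNS, §4 Lemma 4.1 (iii) (4.8), §6.4; cell vocabulary (`IsDSSWave`, `Surviving`, `IsEternal`, `UniformBound`, `EternalSurvivingFwd`)] -/
theorem exists_survivingDSSWave_iff_shiftPeriodic {ε₀ : ℝ} (hε : 0 < ε₀)
    {α : Fin m → Fin m → Fin m → ℤ × ℤ × ℤ → ℝ} :
    (∃ (q : ℕ) (π : Equiv.Perm (Fin q)) (T : ℝ) (Φ : Fin q → ℝ → Em m),
        IsDSSWave ε₀ α π T Φ ∧ Surviving 1 ε₀ T ∧ ∃ r x, Φ r x ≠ 0) ↔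
    (∃ (W : ℤ → ℝ → Em m) (q : ℕ) (T : ℝ), 0 < q ∧ 0 < T ∧ dssMu ε₀ T < 1 ∧
        IsEternal ε₀ α W ∧ UniformBound W ∧
        (∀ (n : ℤ) (σ : ℝ), W (n + q) σ = W n (σ - q * T)) ∧ EternalSurvivingFwd 1 ε₀ W) := by
  constructor
  · rintro ⟨q, π, T, Φ, hW, hS, r₀, x₀, hne⟩
    refine ⟨dssEmbed π T Φ r₀, orderOf π, T, orderOf_pos π, hW.delay_pos, hS.2,
      hW.isEternal_dssEmbed r₀, uniformBound_dssEmbed hW r₀, fun n σ => ?_,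
      eternalSurvivingFwd_dssEmbed hε hW.delay_pos hS hne⟩
    have hπ : (π ^ (n + ((orderOf π : ℕ) : ℤ))) r₀ = (π ^ n) r₀ := by
      rw [zpow_add, zpow_natCast, pow_orderOf_eq_one, mul_one]
    simp only [dssEmbed, hπ]
    push_cast
    ring_nf
  · rintro ⟨W, q, T, hq, hT, hμ, hW, hU, hper, hS⟩
    exact survivingDSSWave_of_shiftPeriodic hW hq hT hper
      ⟨inv_le_dssMu_of_shiftPeriodic hε hW hU hq hper hS, hμ⟩ hS

/-- **`stub_eternalIsDSS` ⟺ THE BOUNDED PERIODIC-COMPANION PROPERTY** — the registered stub signature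
(skeleton `9d85f4d387c689cd` of item 20206, left side verbatim) is EQUIVALENT to: below a threshold, every
`E₂(R)` table carrying a forward-(S₁)-surviving admissible eternal solution carries a uniformly bounded
SHIFT-PERIODIC one (`q ≥ 1`, `T > 0`, `e^{2T} < (1+ε₀)^5`) surviving forward. This is what «classification»
asks: asymptotic shift-periodicity of surviving eternal solutions of the renormalised lattice (open).
[cite: Tao2016AveragedNS, §4 Thm. 4.2 (statement shape), Lemma 4.1 (4.8), §6.4; cell vocabulary] -/
theorem stub_eternalIsDSS_iff_boundedPeriodicCompanions :
    (∀ R : ℝ, 1 ≤ R → ∃ εs : ℝ, 0 < εs ∧ ∀ ε₀ : ℝ, 0 < ε₀ → ε₀ ≤ εs →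
      ∀ α : (Fin 4 → Fin 4 → Fin 4 → ℤ × ℤ × ℤ → ℝ),
        Literature.Analysis.FluidPDE.TaoCascade.InTableClass R α →
        (∃ W : ℤ → ℝ → Literature.Analysis.FluidPDE.TaoCascade.Em 4,
          Literature.Analysis.FluidPDE.TaoCascade.IsEternal ε₀ α W ∧
          Literature.Analysis.FluidPDE.TaoCascade.EternalSurvivingFwd 1 ε₀ W) →
        ∃ (q : ℕ) (π : Equiv.Perm (Fin q)) (T : ℝ)
          (Φ : Fin q → ℝ → Literature.Analysis.FluidPDE.TaoCascade.Em 4),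
          Literature.Analysis.FluidPDE.TaoCascade.IsDSSWave ε₀ α π T Φ ∧
          Literature.Analysis.FluidPDE.TaoCascade.Surviving 1 ε₀ T ∧ ∃ r x, Φ r x ≠ 0) ↔
    (∀ R : ℝ, 1 ≤ R → ∃ εs : ℝ, 0 < εs ∧ ∀ ε₀ : ℝ, 0 < ε₀ → ε₀ ≤ εs →
      ∀ α : (Fin 4 → Fin 4 → Fin 4 → ℤ × ℤ × ℤ → ℝ), InTableClass R α →
        (∃ W : ℤ → ℝ → Em 4, IsEternal ε₀ α W ∧ EternalSurvivingFwd 1 ε₀ W) →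
        ∃ (W : ℤ → ℝ → Em 4) (q : ℕ) (T : ℝ), 0 < q ∧ 0 < T ∧ dssMu ε₀ T < 1 ∧
          IsEternal ε₀ α W ∧ UniformBound W ∧
          (∀ (n : ℤ) (σ : ℝ), W (n + q) σ = W n (σ - q * T)) ∧ EternalSurvivingFwd 1 ε₀ W) := by
  refine forall_congr' fun R => forall_congr' fun _ => exists_congr fun εs => and_congr_right fun _ =>
    forall_congr' fun ε₀ => forall_congr' fun hε => forall_congr' fun _ => forall_congr' fun α =>
    forall_congr' fun _ => forall_congr' fun _ => ?_
  exact exists_survivingDSSWave_iff_shiftPeriodic hε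

end BlowupRigidityOne

end Summit.NavierStokesRegularity.NavierStokesRegularity.Theorems

end
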